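import Summits.ABC.StewartYu.PadicW80Par
import HarnessLib

/-!
# The `p`-adic Waldschmidt parameter record — part B (sequel of `PadicW80Par`)

Support file (plain definitions and theorems; no named facts): continuation of the twin of
`Waldschmidt1980Params/ParamsB/Sizes/Numeric/Main` on the record `PadicW80Par`
(design, HOME/p1/WP-A4-table.md: `V_max` inside the logarithms `W⋆, G` and an ARBITRARY eliminated size
`1 ≤ V_el ≤ V_max` in `U` — p2's FLAG F-p2-3; `c_S = 2¹⁵` — the `p`-adic zeros-per-`𝔘` ratio; all names carry a
suffix `p` to keep them apart from the archimedean record `W80Par`). [cite: Waldschmidt1980, §3.2–3.5 (pp. 264–274)]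
-/

noncomputable section

open Finset Real
open Literature.NumberTheory.Transcendental Literature.NumberTheory.Transcendental.Waldschmidt1980

namespace Summit.ABC.StewartYu

namespace PadicW80Par

variable {d : ℕ} (P : PadicW80Par d)

/-- `U/(c_L' m 2^{m+1} S₀ V_θ) ≥ 2`. [folklore] -/
theorem two_le_U_div_Lθden : (2 : ℝ) ≤ P.Up / (cLp' * mRp d * 2 ^ (d + 2) * P.S₀p * P.Vel) := by
  rw [le_div_iff₀ P.den_Lθ_pos]
  have h := P.U_div_ge
  rw [le_div_iff₀ (by positivity)] at h
  have hS := P.S₀_le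
  have hm := (two_le_mR P)
  have hG : 11 * mRp d ≤ P.Gp := P.eleven_mR_le_G
  have hVθ := P.one_le_Vθ
  have hW := P.one_le_Wstar
  have hV1 : 1 ≤ ∏ j, P.Vs j := by
    have : ∏ _j : Fin d, (1 : ℝ) ≤ ∏ j, P.Vs j := prod_le_prod (fun _ _ => zero_le_one) fun j _ => P.hV j
    simpa using this
  -- `2 · c_L' m 2^{d+2} S₀ Vθ ≤ 2^{29} m² W⋆ Vθ ≤ 2^{49m} G (∏V) Vθ W⋆ 2^{d+1}`
  unfold cLp' cSp at *
  have hmm : mRp d * mRp d ≤ 2 ^ (2 * (d + 1)) := by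
    have hmle : mRp d ≤ 2 ^ (d + 1) := by
      unfold mRp
      have : ((d : ℝ) + 1) = ((d + 1 : ℕ) : ℝ) := by push_cast; ring
      rw [this]; exact_mod_cast (Nat.lt_two_pow_self).le
    calc mRp d * mRp d ≤ 2 ^ (d + 1) * 2 ^ (d + 1) := mul_le_mul hmle hmle (mR_pos P).le (by positivity)
      _ = 2 ^ (2 * (d + 1)) := by rw [← pow_add]; ring_nf
  calc 2 * (2 ^ 12 * mRp d * 2 ^ (d + 2) * (P.S₀p : ℝ) * P.Vel)
      ≤ 2 * (2 ^ 12 * mRp d * 2 ^ (d + 2) * (2 * (2 ^ 15 * mRp d * P.Wstarp)) * P.Vel) := by gcongr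
    _ = 2 ^ 30 * (mRp d * mRp d) * (2 ^ (d + 1) * P.Wstarp * P.Vel) := by ring
    _ ≤ 2 ^ 30 * 2 ^ (2 * (d + 1)) * (2 ^ (d + 1) * P.Wstarp * P.Vel) := by gcongr
    _ = 2 ^ (30 + 2 * (d + 1)) * 1 * 1 * P.Vel * P.Wstarp * 2 ^ (d + 1) := by rw [pow_add]; ring
    _ ≤ 2 ^ (49 * (d + 1)) * P.Gp * (∏ j, P.Vs j) * P.Vel * P.Wstarp * 2 ^ (d + 1) := by
        have hG0 : 0 ≤ P.Gp := by linarith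
        have hG1 : 1 ≤ P.Gp := by linarith
        have hpow : (2 : ℝ) ^ (30 + 2 * (d + 1)) ≤ 2 ^ (49 * (d + 1)) :=
          pow_le_pow_right₀ (by norm_num) (by omega)
        gcongr
    _ = 2 ^ (49 * (d + 1)) * P.Gp * ((∏ j, P.Vs j) * P.Vel) * P.Wstarp * 2 ^ (d + 1) := by ring
    _ ≤ P.Up := h

/-- `U/(2 c_L' m 2^{m+1} S₀ V_θ) ≤ L_θ`. [folklore] -/
theorem Lθ_ge : P.Up / (cLp' * mRp d * 2 ^ (d + 2) * P.S₀p * P.Vel) / 2 ≤ P.Lθp := by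
  unfold Lθp
  have h1 := Nat.lt_floor_add_one (P.Up / (cLp' * mRp d * 2 ^ (d + 2) * P.S₀p * P.Vel))
  have h2 := P.two_le_U_div_Lθden
  linarith

/-- `1 ≤ L_θ`. [folklore] -/
theorem one_le_Lθ : 1 ≤ P.Lθp := by
  have h := P.Lθ_ge
  have h2 := P.two_le_U_div_Lθden
  have : (1 : ℝ) ≤ P.Lθp := by linarith
  exact_mod_cast this

/-- `L_θ < 2^{J₀}`. [folklore] -/
theorem Lθ_lt_two_pow : P.Lθp < 2 ^ P.J₀p := Nat.lt_pow_succ_log_self one_lt_two _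

/-- `2^{J₀} ≤ 2 L_θ`. [folklore] -/
theorem two_pow_le : 2 ^ P.J₀p ≤ 2 * P.Lθp := by
  unfold J₀p
  rw [pow_succ]
  have := Nat.pow_log_le_self 2 (show P.Lθp ≠ 0 by have := P.one_le_Lθ; omega)
  omega

/-- `1 ≤ J₀`. [folklore] -/
theorem one_le_J₀ : 1 ≤ P.J₀p := Nat.le_add_left 1 _

/-- **`T ≥ 2¹¹ m² V_θ L_θ`**: the derivatives outnumber the smallest exponent range by the
factor `c_L' c_S m² V_θ/c_T` — the source of all the room in the numerical conditions
(`T/2^{J₀} ≥ 2¹⁰ m² V_θ`). [cite: Waldschmidt1980, (3.10) and (3.14) (p. 265)] -/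
theorem T_ge_Lθ : (2 : ℝ) ^ 11 * mRp d ^ 2 * P.Vel * P.Lθp ≤ P.Tp := by
  have hT := P.T_ge
  have hL := P.Lθ_le
  have hS := P.S₀_ge
  have hm := (mR_pos P)
  have hVθ := P.one_le_Vθ
  have hW := P.one_le_Wstar
  have hU := P.U_pos
  refine le_trans ?_ hT
  -- `2¹¹ m² Vθ · U/(c_L' m 2^{d+2} S₀ Vθ) ≤ U/(2 c_T 2^{d+1} W⋆)` since `S₀ ≥ c_S m W⋆`
  unfold cTp cLp' cSp at *
  have hden : 0 < (2 : ℝ) ^ 12 * mRp d * 2 ^ (d + 2) * P.S₀p * P.Vel := by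
    have := P.S₀_pos; positivity
  calc (2 : ℝ) ^ 11 * mRp d ^ 2 * P.Vel * P.Lθp
      ≤ 2 ^ 11 * mRp d ^ 2 * P.Vel * (P.Up / (2 ^ 12 * mRp d * 2 ^ (d + 2) * P.S₀p * P.Vel)) := by gcongr
    _ = P.Up * (mRp d / (2 * 2 ^ (d + 2) * P.S₀p)) := by field_simp
    _ ≤ P.Up * (mRp d / (2 * 2 ^ (d + 2) * (2 ^ 15 * mRp d * P.Wstarp))) := by
        apply mul_le_mul_of_nonneg_left _ hU.le
        apply div_le_div_of_nonneg_left hm.le (by positivity)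
        gcongr
    _ = P.Up / (2 ^ 16 * 2 ^ (d + 1) * P.Wstarp) / 2 := by field_simp; ring
    _ ≤ P.Up / (2 ^ 14 * 2 ^ (d + 1) * P.Wstarp) / 2 := by
        gcongr <;> norm_num


/-! ## Part B (twin of `Waldschmidt1980ParamsB`) -/


/-! ### The unit and the bound -/

/-- The unit `𝔘 = U / 2ᵐ` (`m = d + 1`). [cite: Waldschmidt1980, §3.3 (3.19) (p. 269)] -/
def 𝔘p : ℝ := P.Up / 2 ^ (d + 1)

/-- The common bound `𝔅 = exp(𝔘/64)` of the moderate quantities. [folklore] -/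
def 𝔅p : ℝ := Real.exp (P.𝔘p / 64)

/-- `U = 2ᵐ 𝔘`. [folklore] -/
theorem U_eq : P.Up = 2 ^ (d + 1) * P.𝔘p := by
  unfold 𝔘p; field_simp

/-- **`𝔘 ≥ 2^{49m} G (∏Vⱼ) V_θ W⋆`.** [folklore] -/
theorem 𝔘_ge : (2 : ℝ) ^ (49 * (d + 1)) * P.Gp * ((∏ j, P.Vs j) * P.Vel) * P.Wstarp ≤ P.𝔘p := P.U_div_ge

/-- `1 ≤ ∏ Vⱼ`. [folklore] -/
theorem one_le_prodV : (1 : ℝ) ≤ ∏ j, P.Vs j := by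
  have : ∏ _j : Fin d, (1 : ℝ) ≤ ∏ j, P.Vs j := prod_le_prod (fun _ _ => zero_le_one) fun j _ => P.hV j
  simpa using this

/-- `1 ≤ G`. [folklore] -/
theorem one_le_G : (1 : ℝ) ≤ P.Gp := by
  have := P.eleven_mR_le_G; have := two_le_mR P; nlinarith

/-- **`2⁹⁸ W⋆ ≤ 𝔘`** (`m ≥ 2`). [folklore] -/
theorem Wstar_le_𝔘 : (2 : ℝ) ^ 98 * P.Wstarp ≤ P.𝔘p := by
  have h := P.𝔘_ge
  have hG := P.one_le_G; have hV := P.one_le_prodV; have hVθ := P.one_le_Vθ; have hW := P.one_le_Wstar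
  have hd : 98 ≤ 49 * (d + 1) := by have := P.hd; omega
  calc (2 : ℝ) ^ 98 * P.Wstarp ≤ 2 ^ (49 * (d + 1)) * P.Wstarp := by gcongr; norm_num
    _ = 2 ^ (49 * (d + 1)) * 1 * (1 * 1) * P.Wstarp := by ring
    _ ≤ 2 ^ (49 * (d + 1)) * P.Gp * ((∏ j, P.Vs j) * P.Vel) * P.Wstarp := by gcongr
    _ ≤ P.𝔘p := h

/-- `2⁹⁸ G ≤ 𝔘`. [folklore] -/
theorem G_le_𝔘 : (2 : ℝ) ^ 98 * P.Gp ≤ P.𝔘p := by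
  have h := P.𝔘_ge
  have hG := P.one_le_G; have hV := P.one_le_prodV; have hVθ := P.one_le_Vθ; have hW := P.one_le_Wstar
  have hd : 98 ≤ 49 * (d + 1) := by have := P.hd; omega
  calc (2 : ℝ) ^ 98 * P.Gp ≤ 2 ^ (49 * (d + 1)) * P.Gp := by gcongr; norm_num
    _ = 2 ^ (49 * (d + 1)) * P.Gp * (1 * 1) * 1 := by ring
    _ ≤ 2 ^ (49 * (d + 1)) * P.Gp * ((∏ j, P.Vs j) * P.Vel) * P.Wstarp := by gcongr
    _ ≤ P.𝔘p := h

/-- `2⁹⁸ (∑Vⱼ + V_θ + 1)… `: the sizes are lower-order, `(∏Vⱼ) V_θ ≤ 2⁻⁹⁸ 𝔘`. [folklore] -/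
theorem prodV_le_𝔘 : (2 : ℝ) ^ 98 * ((∏ j, P.Vs j) * P.Vel) ≤ P.𝔘p := by
  have h := P.𝔘_ge
  have hG := P.one_le_G; have hV := P.one_le_prodV; have hVθ := P.one_le_Vθ; have hW := P.one_le_Wstar
  have hd : 98 ≤ 49 * (d + 1) := by have := P.hd; omega
  have h0 : 0 ≤ (∏ j, P.Vs j) * P.Vel := by positivity
  calc (2 : ℝ) ^ 98 * ((∏ j, P.Vs j) * P.Vel) ≤ 2 ^ (49 * (d + 1)) * ((∏ j, P.Vs j) * P.Vel) := by gcongr; norm_num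
    _ = 2 ^ (49 * (d + 1)) * 1 * ((∏ j, P.Vs j) * P.Vel) * 1 := by ring
    _ ≤ 2 ^ (49 * (d + 1)) * P.Gp * ((∏ j, P.Vs j) * P.Vel) * P.Wstarp := by gcongr
    _ ≤ P.𝔘p := h

/-- `∑ Vⱼ + V_θ ≤ (d+1) · (∏Vⱼ) V_θ` (each size is at most the product of all). [folklore] -/
theorem sumV_le : (∑ j, P.Vs j) + P.Vel ≤ (mRp d) * ((∏ j, P.Vs j) * P.Vel) := by
  have hVθ := P.one_le_Vθ
  have hVj : ∀ j, P.Vs j ≤ (∏ i, P.Vs i) * P.Vel := by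
    intro j
    have h1 : P.Vs j ≤ ∏ i, P.Vs i := by
      rw [← Finset.mul_prod_erase _ _ (mem_univ j)]
      have : 1 ≤ ∏ i ∈ (univ : Finset (Fin d)).erase j, P.Vs i := by
        have : ∏ _i ∈ (univ : Finset (Fin d)).erase j, (1 : ℝ) ≤ ∏ i ∈ (univ : Finset (Fin d)).erase j, P.Vs i :=
          prod_le_prod (fun _ _ => zero_le_one) fun i _ => P.hV i
        simpa using this
      have h0 : 0 ≤ P.Vs j := le_trans zero_le_one (P.hV j)
      nlinarith
    have h0 : 0 ≤ ∏ i, P.Vs i := le_trans zero_le_one P.one_le_prodV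
    nlinarith
  have hθ : P.Vel ≤ (∏ i, P.Vs i) * P.Vel := le_mul_of_one_le_left (by linarith) P.one_le_prodV
  calc (∑ j, P.Vs j) + P.Vel ≤ (∑ _j : Fin d, (∏ i, P.Vs i) * P.Vel) + (∏ i, P.Vs i) * P.Vel :=
        add_le_add (sum_le_sum fun j _ => hVj j) hθ
    _ = (mRp d) * ((∏ j, P.Vs j) * P.Vel) := by
        simp only [sum_const, card_univ, Fintype.card_fin, nsmul_eq_mul]; unfold mRp; ring

/-- `m ≤ W⋆/9 ≤ 2⁻⁹⁸ 𝔘`. [folklore] -/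
theorem mR_le_𝔘 : (2 : ℝ) ^ 98 * mRp d ≤ P.𝔘p := by
  have h1 := P.nine_mR_le_Wstar; have h2 := P.Wstar_le_𝔘; have := mR_pos P
  nlinarith

/-- `∑Vⱼ + V_θ ≤ 2⁻⁹⁰ 𝔘`. [folklore] -/
theorem sumV_le_𝔘 : (2 : ℝ) ^ 90 * ((∑ j, P.Vs j) + P.Vel) ≤ P.𝔘p := by
  have h1 := P.sumV_le; have h2 := P.prodV_le_𝔘; have h3 := P.mR_le_𝔘
  have hm := mR_pos P
  have h0 : 0 ≤ (∏ j, P.Vs j) * P.Vel := by have := P.one_le_prodV; have := P.one_le_Vθ; positivity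
  -- `m · X ≤ (𝔘/2^98)(𝔘/2^98)`?? no: use `m X ≤ 2^{-98} 𝔘 · X`-free bound: `m ≤ 2^8` is false in general;
  -- instead `∑V + Vθ ≤ m X` and `m ≤ 𝔘/2^98`, `X ≤ 𝔘/2^98` would give a quadratic bound; we use
  -- `𝔘 ≥ 2^{49m} X ≥ 2^{90} · 2^{8} m · X` for `m ≥ 2` (`2^{49m−98} ≥ m`).
  have h := P.𝔘_ge
  have hG := P.one_le_G; have hW := P.one_le_Wstar
  have hpow : (2 : ℝ) ^ 90 * mRp d ≤ 2 ^ (49 * (d + 1)) := by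
    have hm2 : mRp d ≤ 2 ^ (d + 1) := by
      unfold mRp
      have : ((d : ℝ) + 1) = ((d + 1 : ℕ) : ℝ) := by push_cast; ring
      rw [this]; exact_mod_cast (Nat.lt_two_pow_self).le
    have hd := P.hd
    calc (2 : ℝ) ^ 90 * mRp d ≤ 2 ^ 90 * 2 ^ (d + 1) := by gcongr
      _ = 2 ^ (91 + d) := by rw [← pow_add]; ring_nf
      _ ≤ 2 ^ (49 * (d + 1)) := pow_le_pow_right₀ (by norm_num) (by omega)
  calc (2 : ℝ) ^ 90 * ((∑ j, P.Vs j) + P.Vel) ≤ 2 ^ 90 * ((mRp d) * ((∏ j, P.Vs j) * P.Vel)) := by gcongr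
    _ = (2 ^ 90 * mRp d) * ((∏ j, P.Vs j) * P.Vel) := by ring
    _ ≤ 2 ^ (49 * (d + 1)) * ((∏ j, P.Vs j) * P.Vel) := by gcongr
    _ = 2 ^ (49 * (d + 1)) * 1 * ((∏ j, P.Vs j) * P.Vel) * 1 := by ring
    _ ≤ 2 ^ (49 * (d + 1)) * P.Gp * ((∏ j, P.Vs j) * P.Vel) * P.Wstarp := by
        have h49 : (0 : ℝ) ≤ 2 ^ (49 * (d + 1)) := pow_nonneg zero_le_two _
        have hG0 : 0 ≤ P.Gp := by linarith
        exact mul_le_mul (mul_le_mul_of_nonneg_right (mul_le_mul_of_nonneg_left hG h49) h0) hW zero_le_one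
          (mul_nonneg (mul_nonneg h49 hG0) h0)
    _ ≤ P.𝔘p := h

/-- `0 < 𝔘`, indeed `2⁹⁸ ≤ 𝔘`. [folklore] -/
theorem 𝔘_ge' : (2 : ℝ) ^ 98 ≤ P.𝔘p := by
  have := P.Wstar_le_𝔘; have := P.one_le_Wstar; nlinarith

/-- `0 < 𝔘`. [folklore] -/
theorem 𝔘_pos : 0 < P.𝔘p := lt_of_lt_of_le (by norm_num) P.𝔘_ge'

/-- `1 ≤ 𝔅`. [folklore] -/
theorem one_le_𝔅 : 1 ≤ P.𝔅p := Real.one_le_exp (div_nonneg P.𝔘_pos.le (by norm_num))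

/-- `0 < 𝔅`. [folklore] -/
theorem 𝔅_pos : 0 < P.𝔅p := Real.exp_pos _

/-- `exp y ≤ 𝔅` when `y ≤ 𝔘/64`. [folklore] -/
theorem exp_le_𝔅 {y : ℝ} (hy : y ≤ P.𝔘p / 64) : Real.exp y ≤ P.𝔅p := Real.exp_le_exp.mpr hy

/-- `y ≤ 𝔅` when `log y ≤ 𝔘/64`. [folklore] -/
theorem le_𝔅_of_log_le {y : ℝ} (hy : Real.log y ≤ P.𝔘p / 64) : y ≤ P.𝔅p := by
  rcases le_or_gt y 0 with h | h
  · exact h.trans P.𝔅_pos.le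
  · rw [← Real.exp_log h]; exact P.exp_le_𝔅 hy

/-! ### `T`, `S₀` against the unit -/

/-- **`T W⋆ ≤ 𝔘/c_T`.** [folklore] -/
theorem TWstar_le : (P.Tp : ℝ) * P.Wstarp ≤ P.𝔘p / cTp := by
  have h := P.T_le
  have hW := P.one_le_Wstar
  unfold cTp at *
  rw [P.U_eq] at h
  rw [le_div_iff₀ (by positivity)] at h
  rw [le_div_iff₀ (by norm_num)]
  have key : ((P.Tp : ℝ) * P.Wstarp * 2 ^ 14) * 2 ^ (d + 1) ≤ P.𝔘p * 2 ^ (d + 1) := by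
    calc ((P.Tp : ℝ) * P.Wstarp * 2 ^ 14) * 2 ^ (d + 1) = P.Tp * (2 ^ 14 * 2 ^ (d + 1) * P.Wstarp) := by ring
      _ ≤ 2 ^ (d + 1) * P.𝔘p := h
      _ = P.𝔘p * 2 ^ (d + 1) := by ring
  exact le_of_mul_le_mul_right key (by positivity)

/-- `T ≤ 𝔘/c_T`. [folklore] -/
theorem T_le_𝔘 : (P.Tp : ℝ) ≤ P.𝔘p / cTp := by
  have h := P.TWstar_le; have hW := P.one_le_Wstar
  have hT : (0 : ℝ) ≤ P.Tp := Nat.cast_nonneg _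
  nlinarith

/-- `0 < T` (real). [folklore] -/
theorem T_pos : (0 : ℝ) < P.Tp := by have := P.one_le_T; exact_mod_cast this

end PadicW80Par

end Summit.ABC.StewartYu

end
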